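import Summits.KontsevichZagierPeriods.KontsevichZagierPeriods.Theorems.HurwitzMicroSectorsNormalFormPrincipleAlgCarriers
import Summits.KontsevichZagierPeriods.KontsevichZagierPeriods.Theorems.HurwitzMicroSectorsNormalFormPrincipleSlabASubPtK24

/-!
# `NormalFormPrinciple` (stmt-KontsevichZagierPeriods-3869), line `SketchIdeator1` —
# the leaf `stub_boxRigidity` in dimension one — quadratic-pole integrands and the reduction formulas

Pure proof file (lead seat c3; `--supports` the crux). Representations with integrands
`(A(x−u) + B)/((x−u)²+v²)ⁿ` (`v ≠ 0`, real algebraic data): existence, semialgebraicity, continuity,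
the derivatives of `α/((x−u)²+v²)^{n+1}` and `α(x−u)/((x−u)²+v²)^{n+1}`, and the two reduction moves
for higher quadratic poles (`quad_highA_sub_pt_mem_relations`: the odd part is a point;
`quad_highB_mem_relations`: the classical reduction formula for the even part), both one
Newton–Leibniz move (`…SlabASubPtK24`, `SlabA.slabA_sub_pt_mem_relations`) plus integrand additivity.

Sources: M. Kontsevich, D. Zagier, *Periods* (2001), §1.2 rules (1), (3). No definitions are introduced.
-/

noncomputable section

open MeasureTheory Set Finset
open scoped Polynomial
open Literature.NumberTheory.Transcendental Literature.NumberTheory.Transcendental.KZ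
open Literature.ModelTheory.ExponentialFields (IsSemialgebraic isSemialgebraic_univ)

namespace Summit.KontsevichZagierPeriods.HurwitzMicroSectors.NormalFormPrinciple.PiBox

namespace Dlog

open Summit.KontsevichZagierPeriods.HurwitzMicroSectors.NormalFormPrinciple.Negative
  (setIntegral_fin_one integrableOn_fin_one)

/-! ## Representations from continuous semialgebraic integrands -/

/-- `[(a,b), f]` exists for algebraic `a, b` and `f` semialgebraic on the open slab and continuous on
the closed one. [cite: KontsevichZagier2001, §1.1] -/
theorem exists_rep_of_continuousOn {a b : ℝ} (ha : IsAlgebraic ℚ a) (hb : IsAlgebraic ℚ b) (f : ℝ → ℝ)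
    (hf : IsSemialgebraicFunOn ℚ {x : Fin 1 → ℝ | x 0 ∈ Set.Ioo a b} (fun x => f (x 0)))
    (hfc : ContinuousOn f (Set.Icc a b)) :
    ∃ N : IntegralRep 1, N.domain = {x | x 0 ∈ Set.Ioo a b} ∧ N.integrand = fun x => f (x 0) := by
  have hdom := isSemialgebraic_setOf_apply_mem_Ioo_of_isAlgebraic ha hb (0 : Fin 1)
  have hint : IntegrableOn (fun x : Fin 1 → ℝ => f (x 0)) {x : Fin 1 → ℝ | x 0 ∈ Set.Ioo a b} := by
    rw [integrableOn_fin_one]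
    exact (hfc.integrableOn_compact isCompact_Icc).mono_set Set.Ioo_subset_Icc_self
  exact ⟨⟨_, _, hdom, hf, hint⟩, rfl, rfl⟩

/-! ## The quadratic-pole integrands `(A(x−u) + B)/((x−u)² + v²)ⁿ` -/

/-- Positivity of `(t − u)² + v²` for `v ≠ 0`. [folklore] -/
theorem quad_pos {u v : ℝ} (hv0 : v ≠ 0) (t : ℝ) : 0 < (t - u) ^ 2 + v ^ 2 :=
  add_pos_of_nonneg_of_pos (sq_nonneg _) (lt_of_le_of_ne (sq_nonneg v) (Ne.symm (pow_ne_zero 2 hv0)))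

/-- `x ↦ (A(x₀−u) + B)/((x₀−u)² + v²)ⁿ` is `ℚ`-semialgebraic for real algebraic `A, B, u, v`, `v ≠ 0`.
[cite: BochnakCosteRoy1998, §2.2] -/
theorem isSemialgebraicFunOn_quad {s : Set (Fin 1 → ℝ)} (hs : IsSemialgebraic ℚ s) {A B u v : ℝ}
    (hA : IsAlgebraic ℚ A) (hB : IsAlgebraic ℚ B) (hu : IsAlgebraic ℚ u) (hv : IsAlgebraic ℚ v)
    (hv0 : v ≠ 0) (n : ℕ) :
    IsSemialgebraicFunOn ℚ s (fun x => (A * (x 0 - u) + B) / ((x 0 - u) ^ 2 + v ^ 2) ^ n) := by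
  set AK : algebraicClosure ℚ ℝ := ⟨A, mem_algebraicClosure_iff.mpr hA⟩
  set BK : algebraicClosure ℚ ℝ := ⟨B, mem_algebraicClosure_iff.mpr hB⟩
  set uK : algebraicClosure ℚ ℝ := ⟨u, mem_algebraicClosure_iff.mpr hu⟩
  set vK : algebraicClosure ℚ ℝ := ⟨v, mem_algebraicClosure_iff.mpr hv⟩
  have hP : ∀ x : Fin 1 → ℝ, (Polynomial.aeval (x 0) (Polynomial.C AK * (Polynomial.X - Polynomial.C uK) +
      Polynomial.C BK : (algebraicClosure ℚ ℝ)[X]) : ℝ) = A * (x 0 - u) + B := by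
    intro x
    simp only [map_add, map_sub, map_mul, Polynomial.aeval_X, Polynomial.aeval_C]
    rfl
  have hQ : ∀ x : Fin 1 → ℝ, (Polynomial.aeval (x 0) (((Polynomial.X - Polynomial.C uK) ^ 2 +
      Polynomial.C (vK ^ 2)) ^ n : (algebraicClosure ℚ ℝ)[X]) : ℝ) = ((x 0 - u) ^ 2 + v ^ 2) ^ n := by
    intro x
    simp only [map_add, map_sub, map_pow, Polynomial.aeval_X, Polynomial.aeval_C]
    rfl
  refine (AlgSplitK5.isSemialgebraicFunOn_aevalK_div hs (Polynomial.C AK * (Polynomial.X - Polynomial.C uK) +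
    Polynomial.C BK) (((Polynomial.X - Polynomial.C uK) ^ 2 + Polynomial.C (vK ^ 2)) ^ n)
    fun x _ => ?_).congr fun x _ => ?_
  · rw [hQ]; exact pow_ne_zero _ (quad_pos hv0 (x 0)).ne'
  · show (Polynomial.aeval (x 0) (Polynomial.C AK * (Polynomial.X - Polynomial.C uK) +
      Polynomial.C BK : (algebraicClosure ℚ ℝ)[X]) : ℝ) / (Polynomial.aeval (x 0)
        (((Polynomial.X - Polynomial.C uK) ^ 2 + Polynomial.C (vK ^ 2)) ^ n :
          (algebraicClosure ℚ ℝ)[X]) : ℝ) = _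
    rw [hP, hQ]

/-- Continuity of `t ↦ (A(t−u) + B)/((t−u)² + v²)ⁿ` (`v ≠ 0`). [folklore] -/
theorem continuous_quad {A B u v : ℝ} (hv0 : v ≠ 0) (n : ℕ) :
    Continuous fun t : ℝ => (A * (t - u) + B) / ((t - u) ^ 2 + v ^ 2) ^ n :=
  Continuous.div (by fun_prop) (by fun_prop) fun t => pow_ne_zero _ (quad_pos hv0 t).ne'

/-- **Existence**: `[(a,b), (A(x−u) + B)/((x−u)² + v²)ⁿ]` for real algebraic data, `v ≠ 0`.
[cite: KontsevichZagier2001, §1.1] -/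
theorem exists_quadRep {a b A B u v : ℝ} (ha : IsAlgebraic ℚ a) (hb : IsAlgebraic ℚ b)
    (hA : IsAlgebraic ℚ A) (hB : IsAlgebraic ℚ B) (hu : IsAlgebraic ℚ u) (hv : IsAlgebraic ℚ v)
    (hv0 : v ≠ 0) (n : ℕ) :
    ∃ N : IntegralRep 1, N.domain = {x | x 0 ∈ Set.Ioo a b} ∧
      N.integrand = fun x => (A * (x 0 - u) + B) / ((x 0 - u) ^ 2 + v ^ 2) ^ n :=
  exists_rep_of_continuousOn ha hb (fun t => (A * (t - u) + B) / ((t - u) ^ 2 + v ^ 2) ^ n)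
    (isSemialgebraicFunOn_quad (isSemialgebraic_setOf_apply_mem_Ioo_of_isAlgebraic ha hb 0)
      hA hB hu hv hv0 n) (continuous_quad hv0 n).continuousOn

/-! ## Derivatives of the primitives -/

/-- `d/dt [a/((t−u)²+v²)^{n+1}] = −2(n+1)a(t−u)/((t−u)²+v²)^{n+2}`. [folklore] -/
theorem hasDerivAt_const_div_quadPow (a u v : ℝ) (n : ℕ) (t : ℝ) (hQ : (t - u) ^ 2 + v ^ 2 ≠ 0) :
    HasDerivAt (fun y => a / ((y - u) ^ 2 + v ^ 2) ^ (n + 1))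
      (-(2 * ((n:ℝ) + 1) * a) * (t - u) / ((t - u) ^ 2 + v ^ 2) ^ (n + 2)) t := by
  have h1 : HasDerivAt (fun y => (y - u) ^ 2 + v ^ 2) (2 * (t - u)) t := by
    refine ((((hasDerivAt_id' t).sub_const u).pow 2).add_const (v ^ 2)).congr_deriv ?_
    norm_num
  have h2 : HasDerivAt (fun y => ((y - u) ^ 2 + v ^ 2) ^ (n + 1))
      (((n:ℝ) + 1) * ((t - u) ^ 2 + v ^ 2) ^ n * (2 * (t - u))) t := by
    refine (h1.pow (n + 1)).congr_deriv ?_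
    rw [Nat.add_sub_cancel]
    push_cast
    ring
  refine ((hasDerivAt_const t a).div h2 (pow_ne_zero _ hQ)).congr_deriv ?_
  rw [div_eq_div_iff (pow_ne_zero 2 (pow_ne_zero _ hQ)) (pow_ne_zero _ hQ)]
  ring

/-- `d/dt [a(t−u)/((t−u)²+v²)^{n+1}] = a((t−u)²+v² − 2(n+1)(t−u)²)/((t−u)²+v²)^{n+2}`. [folklore] -/
theorem hasDerivAt_lin_div_quadPow (a u v : ℝ) (n : ℕ) (t : ℝ) (hQ : (t - u) ^ 2 + v ^ 2 ≠ 0) :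
    HasDerivAt (fun y => a * (y - u) / ((y - u) ^ 2 + v ^ 2) ^ (n + 1))
      (a * (((t - u) ^ 2 + v ^ 2) - 2 * ((n:ℝ) + 1) * (t - u) ^ 2) / ((t - u) ^ 2 + v ^ 2) ^ (n + 2))
      t := by
  have h1 : HasDerivAt (fun y => (y - u) ^ 2 + v ^ 2) (2 * (t - u)) t := by
    refine ((((hasDerivAt_id' t).sub_const u).pow 2).add_const (v ^ 2)).congr_deriv ?_
    norm_num
  have h2 : HasDerivAt (fun y => ((y - u) ^ 2 + v ^ 2) ^ (n + 1))
      (((n:ℝ) + 1) * ((t - u) ^ 2 + v ^ 2) ^ n * (2 * (t - u))) t := by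
    refine (h1.pow (n + 1)).congr_deriv ?_
    rw [Nat.add_sub_cancel]
    push_cast
    ring
  have h0 : HasDerivAt (fun y => a * (y - u)) a t := by
    refine (((hasDerivAt_id' t).sub_const u).const_mul a).congr_deriv ?_
    rw [mul_one]
  refine ((h0.div h2 (pow_ne_zero _ hQ))).congr_deriv ?_
  rw [div_eq_div_iff (pow_ne_zero 2 (pow_ne_zero _ hQ)) (pow_ne_zero _ hQ)]
  ring

/-! ## Higher quadratic poles are Newton–Leibniz moves -/

/-- **The odd part of a higher quadratic pole is a point**: `[(a,b), −2(n+1)α(x−u)/((x−u)²+v²)^{n+2}]`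
is one Newton–Leibniz move from `[pt, F(b) − F(a)]`, `F = α/((x−u)²+v²)^{n+1}`.
[cite: KontsevichZagier2001, §1.2 rule (3)] -/
theorem quad_highA_sub_pt_mem_relations {a b α u v : ℝ} (ha : IsAlgebraic ℚ a) (hb : IsAlgebraic ℚ b)
    (hα : IsAlgebraic ℚ α) (hu : IsAlgebraic ℚ u) (hv : IsAlgebraic ℚ v) (hv0 : v ≠ 0) (hab : a ≤ b)
    (n : ℕ) (N : IntegralRep 1) (hNd : N.domain = {x | x 0 ∈ Set.Ioo a b})
    (hNi : EqOn N.integrand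
      (fun x => -(2 * ((n:ℝ) + 1) * α) * (x 0 - u) / ((x 0 - u) ^ 2 + v ^ 2) ^ (n + 2)) N.domain)
    (Z : IntegralRep 0) (hZd : Z.domain = univ)
    (hZi : Z.integrand = fun _ => α / ((b - u) ^ 2 + v ^ 2) ^ (n + 1) - α / ((a - u) ^ 2 + v ^ 2) ^ (n + 1)) :
    of N - of Z ∈ relations := by
  have hIcc : IsSemialgebraic ℚ {x : Fin 1 → ℝ | x 0 ∈ Set.Icc a b} := SlabA.isSemialgebraic_setOf_apply_mem_Icc ha hb
  have hcA : IsAlgebraic ℚ (-(2 * ((n:ℝ) + 1) * α)) :=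
    (((isAlgebraic_nat (R := ℚ) 2).mul ((isAlgebraic_nat (R := ℚ) n).add isAlgebraic_one)).mul hα).neg
  refine SlabA.slabA_sub_pt_mem_relations ha hb hab
    (fun t => -(2 * ((n:ℝ) + 1) * α) * (t - u) / ((t - u) ^ 2 + v ^ 2) ^ (n + 2))
    (fun t => α / ((t - u) ^ 2 + v ^ 2) ^ (n + 1)) ?_ ?_
    (fun t _ => hasDerivAt_const_div_quadPow α u v n t (quad_pos hv0 t).ne') ?_ N hNd hNi Z hZd hZi
  · exact (isSemialgebraicFunOn_quad hIcc isAlgebraic_zero hα hu hv hv0 (n + 1)).congr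
      fun x _ => by simp only [zero_mul, zero_add]
  · exact (continuous_const.div (by fun_prop) fun t => pow_ne_zero _ (quad_pos hv0 t).ne').continuousOn
  · exact (isSemialgebraicFunOn_quad hIcc hcA isAlgebraic_zero hu hv hv0 (n + 2)).congr
      fun x _ => by simp only [add_zero]

/-- **The even part of a higher quadratic pole reduces** (the classical reduction formula, by rules
(1) and (3)): with `G = α(x−u)/((x−u)²+v²)^{n+1}`,
`[(a,b), 2(n+1)v²α/((x−u)²+v²)^{n+2}] − [pt, G(b) − G(a)] − [(a,b), (2n+1)α/((x−u)²+v²)^{n+1}] ∈ relations`.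
[cite: KontsevichZagier2001, §1.2 rules (1), (3)] -/
theorem quad_highB_mem_relations {a b α u v : ℝ} (ha : IsAlgebraic ℚ a) (hb : IsAlgebraic ℚ b)
    (hα : IsAlgebraic ℚ α) (hu : IsAlgebraic ℚ u) (hv : IsAlgebraic ℚ v) (hv0 : v ≠ 0) (hab : a ≤ b)
    (n : ℕ) (N : IntegralRep 1) (hNd : N.domain = {x | x 0 ∈ Set.Ioo a b})
    (hNi : EqOn N.integrand
      (fun x => (2 * ((n:ℝ) + 1) * v ^ 2 * α) / ((x 0 - u) ^ 2 + v ^ 2) ^ (n + 2)) N.domain)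
    (Z : IntegralRep 0) (hZd : Z.domain = univ)
    (hZi : Z.integrand = fun _ =>
      α * (b - u) / ((b - u) ^ 2 + v ^ 2) ^ (n + 1) - α * (a - u) / ((a - u) ^ 2 + v ^ 2) ^ (n + 1))
    (N' : IntegralRep 1) (hN'd : N'.domain = {x | x 0 ∈ Set.Ioo a b})
    (hN'i : EqOn N'.integrand
      (fun x => ((2 * (n:ℝ) + 1) * α) / ((x 0 - u) ^ 2 + v ^ 2) ^ (n + 1)) N'.domain) :
    of N - of Z - of N' ∈ relations := by
  have hIcc : IsSemialgebraic ℚ {x : Fin 1 → ℝ | x 0 ∈ Set.Icc a b} := SlabA.isSemialgebraic_setOf_apply_mem_Icc ha hb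
  have hIoo : IsSemialgebraic ℚ {x : Fin 1 → ℝ | x 0 ∈ Set.Ioo a b} :=
    isSemialgebraic_setOf_apply_mem_Ioo_of_isAlgebraic ha hb 0
  have hn1 : IsAlgebraic ℚ ((n:ℝ) + 1) := (isAlgebraic_nat (R := ℚ) n).add isAlgebraic_one
  have hcA : IsAlgebraic ℚ (2 * ((n:ℝ) + 1) * v ^ 2 * α) :=
    (((isAlgebraic_nat (R := ℚ) 2).mul hn1).mul (hv.pow 2)).mul hα
  have hc'A : IsAlgebraic ℚ ((2 * (n:ℝ) + 1) * α) :=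
    (((isAlgebraic_nat (R := ℚ) 2).mul (isAlgebraic_nat (R := ℚ) n)).add isAlgebraic_one).mul hα
  -- the derivative `g = G'` as an integrand, and a representation for it
  set g : ℝ → ℝ := fun t => (2 * ((n:ℝ) + 1) * v ^ 2 * α) / ((t - u) ^ 2 + v ^ 2) ^ (n + 2) -
    ((2 * (n:ℝ) + 1) * α) / ((t - u) ^ 2 + v ^ 2) ^ (n + 1) with hg
  have hgsa : ∀ {s : Set (Fin 1 → ℝ)}, IsSemialgebraic ℚ s → IsSemialgebraicFunOn ℚ s (fun x => g (x 0)) := by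
    intro s hs
    have h1 : IsSemialgebraicFunOn ℚ s
        (fun x => (2 * ((n:ℝ) + 1) * v ^ 2 * α) / ((x 0 - u) ^ 2 + v ^ 2) ^ (n + 2)) :=
      (isSemialgebraicFunOn_quad hs isAlgebraic_zero hcA hu hv hv0 (n + 2)).congr
        fun x _ => by simp only [zero_mul, zero_add]
    have h2 : IsSemialgebraicFunOn ℚ s (fun x => ((2 * (n:ℝ) + 1) * α) / ((x 0 - u) ^ 2 + v ^ 2) ^ (n + 1)) :=
      (isSemialgebraicFunOn_quad hs isAlgebraic_zero hc'A hu hv hv0 (n + 1)).congr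
        fun x _ => by simp only [zero_mul, zero_add]
    exact IsSemialgebraicFunOn.sub_holds h1 h2
  have hgc : Continuous g :=
    (continuous_const.div (by fun_prop) fun t => pow_ne_zero _ (quad_pos hv0 t).ne').sub
      (continuous_const.div (by fun_prop) fun t => pow_ne_zero _ (quad_pos hv0 t).ne')
  obtain ⟨N₁, hN₁d, hN₁i⟩ := exists_rep_of_continuousOn ha hb g (hgsa hIoo) hgc.continuousOn
  -- additivity of the integrand
  have hadd : of N - of N₁ - of N' ∈ relations := by
    refine integrandAddRel_subset_relations ⟨1, N, N₁, N', by rw [hN₁d, hNd], by rw [hN'd, hNd],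
      fun x hx => ?_, rfl⟩
    rw [Pi.add_apply, hNi hx, hN₁i, hN'i (by rw [hN'd, ← hNd]; exact hx), hg]
    simp only
    ring
  -- Newton–Leibniz for `g`
  have hNL : of N₁ - of Z ∈ relations := by
    refine SlabA.slabA_sub_pt_mem_relations ha hb hab g
      (fun t => α * (t - u) / ((t - u) ^ 2 + v ^ 2) ^ (n + 1))
      ?_ ?_ (fun t _ => ?_) (hgsa hIcc) N₁ hN₁d (by rw [hN₁i]; exact fun _ _ => rfl) Z hZd hZi
    · exact (isSemialgebraicFunOn_quad hIcc hα isAlgebraic_zero hu hv hv0 (n + 1)).congr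
        fun x _ => by simp only [add_zero]
    · exact ((continuous_quad (A := α) (B := 0) (u := u) hv0 (n + 1)).congr
        fun t => by simp only [add_zero]).continuousOn
    · have hQ := (quad_pos (u := u) hv0 t).ne'
      refine (hasDerivAt_lin_div_quadPow α u v n t hQ).congr_deriv ?_
      rw [hg]
      simp only
      rw [div_sub_div _ _ (pow_ne_zero _ hQ) (pow_ne_zero _ hQ),
        div_eq_div_iff (pow_ne_zero _ hQ) (mul_ne_zero (pow_ne_zero _ hQ) (pow_ne_zero _ hQ))]
      ring
  have : of N - of Z - of N' = (of N - of N₁ - of N') + (of N₁ - of Z) := by abel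
  rw [this]
  exact relations.add_mem hadd hNL

end Dlog

end Summit.KontsevichZagierPeriods.HurwitzMicroSectors.NormalFormPrinciple.PiBox
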